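import Summits.QuantumFields.YangMills.Theorems.PencilRigidityNPointIsotropyDegreeLeTwo
import Summits.QuantumFields.YangMills.Theorems.PencilRigidityNPointIsotropyCorner
import Summits.QuantumFields.YangMills.Theorems.PencilRigidityNPointIsotropyUnorderedRPTransport
import Summits.QuantumFields.YangMills.Theorems.PencilRigidityPlanarToEuclideanSO4

/-!
# `NPointIsotropy`, line quarter-turn-corner-operator — the bet (stub D) holds through degree two

Support file for the lead's stub `stub_eighthTurnIdentity` (crux stmt-QuantumFields-11686, item evidence
`work/D_analysis.md` §1(d)): the eighth-turn identity `𝔖ₘ₊ₙ(Θ(R₈·G₁)* ⊗ R₈·G₂) = 𝔖ₘ₊ₙ(ΘG₁* ⊗ Rq·G₂)` for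
quadrant-supported off-diagonal `G₁, G₂` holds whenever `m + n ≤ 2`, from translations, the radial two-point kernel
and the function residual alone: the two tensor products differ by the planar rotation `R₈⁻¹` (the sector identity
of `PencilRigidityNPointIsotropyCorner`), and in degrees `≤ 2` a translation-invariant family with radial kernel and
function residual is invariant on `⁰𝒮` under every linear isometry (`harmonicKill_degree_le_two` of the sibling line).
So the content of the bet starts at degree `3`, exactly as for every other dress of the regular model-blind core.
Also recorded: a linear isometry of `ℝ⁴` is determined by its values on `e₀,…,e₃`, whence the abstract quarter-turn and
eighth-turn of the stub ARE `planeRot 0 (-π/2)` and `planeRot 0 (-π/4)`. [folklore]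
-/

noncomputable section

namespace Summit.QuantumFields.YangMills.Theorems.NPointIsotropy.QuarterTurnCornerOperator

namespace DegreeLeTwo

open scoped SchwartzMap
open Literature.MathematicalPhysics.QuantumLattice Literature.MathematicalPhysics.AQFT
  Literature.MathematicalPhysics.QuantumFieldTheory
open Summit.QuantumFields.YangMills.Theorems.NPointIsotropy.Negative (E4 RadialKernel NPointRegular)
open Summit.QuantumFields.YangMills.Theorems.CurvatureBoostCovariance.Negative (Translations isOffDiagonal_linActMulti)
open Summit.QuantumFields.YangMills.Theorems.PlanarToEuclidean (four_cases)

variable {n m : ℕ}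

/-- A linear isometry of `ℝ⁴` is determined by its values on the standard basis vectors. [folklore] -/
theorem ext_single {R R' : E4 ≃ₗᵢ[ℝ] E4}
    (h : ∀ i : Fin 4, R (EuclideanSpace.single i 1) = R' (EuclideanSpace.single i 1)) : R = R' := by
  apply LinearIsometryEquiv.toLinearEquiv_injective
  apply LinearEquiv.toLinearMap_injective
  refine (EuclideanSpace.basisFun (Fin 4) ℝ).toBasis.ext fun i => ?_
  simpa using h i

/-- The four coordinate conditions of the stub's quarter-turn pin it: `Rq = planeRot 0 (-π/2)`. [folklore] -/
theorem quarterTurn_eq {Rq : E4 ≃ₗᵢ[ℝ] E4}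
    (h : Rq (EuclideanSpace.single 0 1) = EuclideanSpace.single 1 1 ∧
      Rq (EuclideanSpace.single 1 1) = -EuclideanSpace.single 0 1 ∧
      Rq (EuclideanSpace.single 2 1) = EuclideanSpace.single 2 1 ∧
      Rq (EuclideanSpace.single 3 1) = EuclideanSpace.single 3 1) :
    Rq = planeRot (d := 3) 0 (-(Real.pi / 2)) := by
  obtain ⟨h0, h1, h2, h3⟩ := h
  have hc : Real.cos (-(Real.pi / 2)) = 0 := by rw [Real.cos_neg, Real.cos_pi_div_two]
  have hs : Real.sin (-(Real.pi / 2)) = -1 := by rw [Real.sin_neg, Real.sin_pi_div_two]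
  refine ext_single fun i => ?_
  rcases four_cases i with rfl | rfl | rfl | rfl
  · rw [h0]; ext j; fin_cases j <;> simp [planeRot_apply, hc, hs]
  · rw [h1]; ext j; fin_cases j <;> simp [planeRot_apply, hc, hs]
  · rw [h2]; ext j; fin_cases j <;> simp [planeRot_apply, hc, hs]
  · rw [h3]; ext j; fin_cases j <;> simp [planeRot_apply, hc, hs]

/-- The four coordinate conditions of the stub's eighth-turn pin it: `R₈ = planeRot 0 (-π/4)`. [folklore] -/
theorem eighthTurn_eq {R₈ : E4 ≃ₗᵢ[ℝ] E4}
    (h : R₈ (EuclideanSpace.single 0 1) =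
        (Real.sqrt 2 / 2) • EuclideanSpace.single 0 1 + (Real.sqrt 2 / 2) • EuclideanSpace.single 1 1 ∧
      R₈ (EuclideanSpace.single 1 1) =
        -((Real.sqrt 2 / 2) • EuclideanSpace.single 0 1) + (Real.sqrt 2 / 2) • EuclideanSpace.single 1 1 ∧
      R₈ (EuclideanSpace.single 2 1) = EuclideanSpace.single 2 1 ∧
      R₈ (EuclideanSpace.single 3 1) = EuclideanSpace.single 3 1) :
    R₈ = planeRot (d := 3) 0 (-(Real.pi / 4)) := by
  obtain ⟨h0, h1, h2, h3⟩ := h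
  have hc : Real.cos (-(Real.pi / 4)) = Real.sqrt 2 / 2 := by rw [Real.cos_neg, Real.cos_pi_div_four]
  have hs : Real.sin (-(Real.pi / 4)) = -(Real.sqrt 2 / 2) := by rw [Real.sin_neg, Real.sin_pi_div_four]
  refine ext_single fun i => ?_
  rcases four_cases i with rfl | rfl | rfl | rfl
  · rw [h0]; ext j; fin_cases j <;> simp [planeRot_apply, hc, hs]
  · rw [h1]; ext j; fin_cases j <;> simp [planeRot_apply, hc, hs]
  · rw [h2]; ext j; fin_cases j <;> simp [planeRot_apply, hc, hs]
  · rw [h3]; ext j; fin_cases j <;> simp [planeRot_apply, hc, hs]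

/-- A quadrant-supported test function is positive-time. [folklore] -/
theorem isPositiveTimeMulti_of_quadrant {G : 𝓢((Fin n → E4), ℂ)}
    (hG : tsupport (G : (Fin n → E4) → ℂ) ⊆ {x | ∀ i, 0 < x i 0 ∧ x i 1 < 0}) : IsPositiveTimeMulti G :=
  fun _ hx i => (hG hx i).1

/-- The quarter-turned image of a quadrant-supported test function is positive-time (`Rq Q = {x⁰ > 0, x¹ > 0}`).
[folklore] -/
theorem isPositiveTimeMulti_linActMulti_quarter {G : 𝓢((Fin n → E4), ℂ)}
    (hG : tsupport (G : (Fin n → E4) → ℂ) ⊆ {x | ∀ i, 0 < x i 0 ∧ x i 1 < 0}) :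
    IsPositiveTimeMulti (linActMulti (planeRot (d := 3) 0 (-(Real.pi / 2))) G) := by
  intro x hx i
  have hy := hG (Corner.mem_tsupport_of_mem_tsupport_linActMulti _ G hx) i
  rw [Corner.rot_symm_apply, neg_neg] at hy
  have h1 := hy.2
  have hc : Real.cos (Real.pi / 2) = 0 := Real.cos_pi_div_two
  have hs : Real.sin (Real.pi / 2) = 1 := Real.sin_pi_div_two
  simp only [planeRot_apply, Fin.succ_zero_eq_one, hc, hs, one_ne_zero, if_false, if_true] at h1
  linarith

/-- **The bet through degree two.** For a translation-invariant family with the radial two-point kernel and the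
function residual, the eighth-turn identity of stub `stub_eighthTurnIdentity` holds in all slots with `m + n ≤ 2`
(no reflection positivity, cone or gap needed). [folklore] -/
theorem eighthTurnIdentity_degree_le_two :
    open Literature.MathematicalPhysics.QuantumLattice Literature.MathematicalPhysics.AQFT
      Literature.MathematicalPhysics.QuantumFieldTheory
      Summit.QuantumFields.YangMills.Theorems.CurvatureBoostCovariance.Negative
      Summit.QuantumFields.YangMills.Theorems.NPointIsotropy.Negative in
    ∀ (S₁ : SchwingerFamily E4), Translations S₁ → RadialKernel S₁ → NPointRegular S₁ →
      ∀ (Rq R₈ : E4 ≃ₗᵢ[ℝ] E4),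
        (Rq (EuclideanSpace.single 0 1) = EuclideanSpace.single 1 1 ∧
          Rq (EuclideanSpace.single 1 1) = -EuclideanSpace.single 0 1 ∧
          Rq (EuclideanSpace.single 2 1) = EuclideanSpace.single 2 1 ∧
          Rq (EuclideanSpace.single 3 1) = EuclideanSpace.single 3 1) →
        (R₈ (EuclideanSpace.single 0 1) =
            (Real.sqrt 2 / 2) • EuclideanSpace.single 0 1 + (Real.sqrt 2 / 2) • EuclideanSpace.single 1 1 ∧
          R₈ (EuclideanSpace.single 1 1) =
            -((Real.sqrt 2 / 2) • EuclideanSpace.single 0 1) + (Real.sqrt 2 / 2) • EuclideanSpace.single 1 1 ∧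
          R₈ (EuclideanSpace.single 2 1) = EuclideanSpace.single 2 1 ∧
          R₈ (EuclideanSpace.single 3 1) = EuclideanSpace.single 3 1) →
        ∀ (m n : ℕ), m + n ≤ 2 → ∀ (G₁ : SchwartzMap (Fin m → E4) ℂ) (G₂ : SchwartzMap (Fin n → E4) ℂ),
          tsupport (G₁ : (Fin m → E4) → ℂ) ⊆ {x | ∀ i, 0 < x i 0 ∧ x i 1 < 0} →
          tsupport (G₂ : (Fin n → E4) → ℂ) ⊆ {x | ∀ i, 0 < x i 0 ∧ x i 1 < 0} →
          IsOffDiagonal G₁ → IsOffDiagonal G₂ →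
          ∀ (H H' : SchwartzMap (Fin (m + n) → E4) ℂ),
            IsAppendTensorOf H (osAdjoint (linActMulti R₈ G₁)) (linActMulti R₈ G₂) →
            IsAppendTensorOf H' (osAdjoint G₁) (linActMulti Rq G₂) →
            S₁ (m + n) H = S₁ (m + n) H' := by
  intro S₁ htr hK hreg Rq R₈ hRq hR₈ m n hmn G₁ G₂ hG₁ hG₂ hG₁o hG₂o H H' hH hH'
  have hRq' : Rq = planeRot (d := 3) 0 (-(Real.pi / 2)) := quarterTurn_eq hRq
  have hR₈' : R₈ = planeRot (d := 3) 0 (-(Real.pi / 4)) := eighthTurn_eq hR₈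
  -- the two witnesses are the concrete tensor products
  have hHeq : H = (osAdjoint (linActMulti R₈ G₁)).appendTensor (linActMulti R₈ G₂) := by
    ext x; rw [hH x, SchwartzMap.appendTensor_apply]
  have hH'eq : H' = (osAdjoint G₁).appendTensor (linActMulti Rq G₂) := by
    ext x; rw [hH' x, SchwartzMap.appendTensor_apply]
  -- the sector identity: `H = R₈⁻¹ · H'`
  have hsec : H = linActMulti (planeRot (d := 3) 0 (Real.pi / 4)) H' := by
    rw [hHeq, hH'eq, hRq', hR₈', Corner.sector_identity]
  -- `H'` is off-diagonal (separated supports, each group off-diagonal)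
  have hH'o : IsOffDiagonal H' := by
    rw [hH'eq, hRq']
    exact UnorderedRP.isOffDiagonal_osAdjoint_appendTensor (isPositiveTimeMulti_of_quadrant hG₁) hG₁o
      (isPositiveTimeMulti_linActMulti_quarter hG₂) (isOffDiagonal_linActMulti hG₂o _)
  rw [hsec]
  exact ComplexRotationBandlimit.harmonicKill_degree_le_two S₁ htr hK hreg _ (m + n) hmn H' hH'o

end DegreeLeTwo

end Summit.QuantumFields.YangMills.Theorems.NPointIsotropy.QuarterTurnCornerOperator

end
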